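import Mathlib
import Summits.HodgeConjecture.FermatCycles.HodgeFermatHypUCertA

/-!
# HYPOTHESIS U by kernel-checked certificates — part 2: order and level certificates, the walk and its soundness (`HodgeFermat/HypUCert.lean`; HF-G23d)

Tree copy (part 2 of 2) of the module `HodgeFermat/HypUCert.lean` of the sibling cell's standalone package
`run/shared/lean/pub/pub-hodgefermat/lean/HodgeFermat/` (440 lines, sha256 `d9c5ed2ef4a27274…`), source lines 225–440 (§4 order certificates `checkOrd`, `checkOrd_sound`, the bound on `tau`; §5 level certificates `checkLevel`; §6 the range walk `walk`, `uRange_of_walk`; §7 the test walk).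
Filed by cell `pub-hfermat`, seat prover-1 gen-2, on the COORDINATOR KEEPER RULING of 2026-08-25 (gem sweep H1: take the
off-gate kernel theorem `thmFstar` through the gate) — here its second namesake, `HodgeFermat/ThmFstarNFinal.lean:29`,
THEOREM F*(3N) at every admissible squarefree level (the first, `DecodingFinal.thmFstar` = THEOREM F* at the prime levels,
landed on 2026-08-25 as `HodgeFermatThmFstar.lean`, seat prover-1 gen-0); this file is one link of the import closure of
`ThmFstarNFinal.thmFstar` on top of that landed chain.  The source module's declarations are VERBATIM those of the cell record
`check/ThmFstarN_standalone.lean` (21 bodies, 438 871 B, sha256 ced731ec52c92191…, hub `lean check` rc 0, 222.2 s, `--axioms …ThmFstarN.thmFstarN` = [propext, Classical.choice, Quot.sound]; pub-hodgefermat `CERT.md` l.987, GATE HF-G33).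
Deviations from the source module, exhaustively: the `import` lines (tree modules `Summits.HodgeConjecture.FermatCycles.
HodgeFermat*` instead of `HodgeFermat.*`); this module docstring; the `set_option`/namespace/`open` preamble (source l.31–35) is repeated at the top because the module is split; one-line docstrings added (gate lint) to `natCast_pow_eq_one_iff`, `checkOrd_sound`, `tau_le_of_pcBound`, `sum_le_of_sumBounds`, `good_of_checkLevel`, `entryOK`, `entryOK_sound`, `walk_sound`, `esTest`, `walk_test`, `uRange_test`. The module docstring is quoted in full in part 1.
Every other line — in particular every declaration's statement and proof — is byte-identical to the source.
HONEST FRAMING: explicit algebraic cycles for specific Hodge classes on Fermat/Delsarte varieties; residual open instances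
listed; no claim on general Hodge.  (This file is arithmetic of CM types / of `(ℤ/N)ˣ`; it claims nothing about cycles.)
-/

set_option autoImplicit false

namespace HodgeFermat.KRFree.HypUCert

open Finset HodgeFermat.KRFree.HypBReduction
/-! ## 4. Order certificates and the bound on `tau` -/

/-- Certificate for one prime `p ∣ N`: either `neg ≠ 0` with `p ^ neg ≡ -1 (mod N/p)`, or
(`neg = 0`) the order `d` of `p` modulo `N/p` with the factorisation `fac` of `d`. -/
structure PC where
  p : ℕ
  neg : ℕ
  d : ℕ
  fac : List (ℕ × ℕ)

/-- Check an exact-order certificate: `x ^ d = 1` and `x ^ (d / q) ≠ 1` for the primes `q ∣ d`. -/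
def checkOrd (p m d : ℕ) (fac : List (ℕ × ℕ)) : Bool :=
  Nat.blt 0 d && (powMod p d m == 1 % m) && ((fac.map fun qe => qe.1 ^ qe.2).prod == d) &&
    fac.all (fun qe => isPrimeB qe.1 && (powMod p (d / qe.1) m != 1 % m))

/-- `(p : ZMod m)^k = 1 ↔ p^k ≡ 1 (mod m)` numerically -/
theorem natCast_pow_eq_one_iff (p m k : ℕ) : ((p : ℕ) : ZMod m) ^ k = 1 ↔ p ^ k % m = 1 % m := by
  rw [← ZMod.natCast_eq_natCast_iff', Nat.cast_pow, Nat.cast_one]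

/-- soundness of the exact-order certificate checker `checkOrd` -/
theorem checkOrd_sound (p m d : ℕ) (fac : List (ℕ × ℕ)) (h : checkOrd p m d fac = true) :
    orderOf ((p : ℕ) : ZMod m) = d := by
  simp only [checkOrd, Bool.and_eq_true, Nat.blt_eq, beq_iff_eq, List.all_eq_true, bne_iff_ne,
    ne_eq] at h
  obtain ⟨⟨⟨hd0, hpow⟩, hprod⟩, hall⟩ := h
  rw [powMod_eq] at hpow
  refine orderOf_eq_of_pow_and_pow_div_prime hd0 ((natCast_pow_eq_one_iff p m d).mpr hpow) ?_
  intro r hr hrd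
  rw [← hprod] at hrd
  obtain ⟨a, ha, hra⟩ := (Prime.dvd_prod_iff hr.prime).mp hrd
  obtain ⟨qe, hqe, rfl⟩ := List.mem_map.mp ha
  have hq : qe.1.Prime := prime_of_isPrimeB _ ((hall qe hqe).1)
  have hrq : r = qe.1 := (Nat.prime_dvd_prime_iff_eq hr hq).mp (hr.dvd_of_dvd_pow hra)
  have hne := (hall qe hqe).2
  rw [powMod_eq] at hne
  rw [ne_eq, natCast_pow_eq_one_iff, hrq]
  exact hne

/-- The certified bound for `tau N c.p`, or `none` if the certificate does not check.
`ps` = the list of primes of `N` (so `φ(N/p) = ∏_{q ≠ p} (q - 1)`). -/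
def pcBound (N : ℕ) (ps : List ℕ) (c : PC) : Option ℕ :=
  if c.neg != 0 then
    (if powMod c.p c.neg (N / c.p) == (N / c.p - 1) % (N / c.p) then some 0 else none)
  else if checkOrd c.p (N / c.p) c.d c.fac then some (((ps.erase c.p).map (· - 1)).prod / c.d)
  else none

/-- a checked certificate bounds `tau N p` -/
theorem tau_le_of_pcBound (N : ℕ) (ps : List ℕ) (c : PC) (b : ℕ)
    (hps : ∀ p ∈ ps, p.Prime) (hnd : ps.Nodup) (hN : ps.prod = N) (hc : c.p ∈ ps)
    (h : pcBound N ps c = some b) : tau N c.p ≤ b := by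
  -- `N / p` is the product of the other primes
  have hp0 : 0 < c.p := (hps _ hc).pos
  have hm : N / c.p = (ps.erase c.p).prod :=
    Nat.div_eq_of_eq_mul_right hp0 (by rw [← hN, ← List.prod_erase hc])
  have hps' : ∀ q ∈ ps.erase c.p, q.Prime := fun q hq => hps q (List.mem_of_mem_erase hq)
  have hm1 : 1 ≤ N / c.p := by rw [hm]; exact prod_primes_pos _ hps'
  unfold pcBound at h
  split_ifs at h with hneg hA hB
  · -- type A: `p ^ neg ≡ -1`
    simp only [beq_iff_eq, powMod_eq] at hA
    have hcast : ((c.p : ℕ) : ZMod (N / c.p)) ^ c.neg = -1 := by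
      have h1 : ((c.p ^ c.neg : ℕ) : ZMod (N / c.p)) = ((N / c.p - 1 : ℕ) : ZMod (N / c.p)) :=
        (ZMod.natCast_eq_natCast_iff' _ _ _).mpr hA
      rw [Nat.cast_pow, Nat.cast_sub hm1, ZMod.natCast_self, Nat.cast_one, zero_sub] at h1
      exact h1
    have ht : tau N c.p = 0 := by
      rw [tau, if_pos ⟨c.neg, hcast⟩]
    cases h
    omega
  · -- type B: exact order
    cases h
    have hord := checkOrd_sound _ _ _ _ hB
    have htot : (N / c.p).totient = ((ps.erase c.p).map (· - 1)).prod := by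
      rw [hm]; exact totient_prod_primes _ hps' (hnd.erase _)
    unfold tau
    split_ifs with hex
    · exact Nat.zero_le _
    · rw [htot, hord]

/-! ## 5. Level certificates -/

/-- Sum of the certified bounds over the certificate list (in order). -/
def sumBounds (N : ℕ) (ps : List ℕ) : List PC → Option ℕ
  | [] => some 0
  | c :: cs =>
      match pcBound N ps c, sumBounds N ps cs with
      | some b, some s => some (b + s)
      | _, _ => none

/-- Check a level: `ps` distinct primes with product `N`, one certificate per prime (same order),
and `6 * (sum of bounds) < ∏ (p - 1) = φ(N)`. -/
def checkLevel (N : ℕ) (ps : List ℕ) (pcs : List PC) : Bool :=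
  nodupB ps && ps.all isPrimeB && (ps.prod == N) && (pcs.map PC.p == ps) &&
    (match sumBounds N ps pcs with
     | some s => Nat.blt (6 * s) ((ps.map (· - 1)).prod)
     | none => false)

/-- the certified bounds sum to an upper bound for `Σ tau` -/
theorem sum_le_of_sumBounds (N : ℕ) (ps : List ℕ) (hps : ∀ p ∈ ps, p.Prime) (hnd : ps.Nodup)
    (hN : ps.prod = N) : ∀ (pcs : List PC) (s : ℕ), (∀ c ∈ pcs, c.p ∈ ps) →
    sumBounds N ps pcs = some s → ((pcs.map PC.p).map (tau N)).sum ≤ s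
  | [], s, _, _ => by simp
  | c :: cs, s, hmem, h => by
      simp only [sumBounds] at h
      split at h
      · rename_i b s' hb hs'
        cases h
        simp only [List.map_cons, List.sum_cons]
        exact Nat.add_le_add (tau_le_of_pcBound N ps c b hps hnd hN (hmem c (by simp)) hb)
          (sum_le_of_sumBounds N ps hps hnd hN cs s' (fun c' hc' => hmem c' (by simp [hc'])) hs')
      · exact absurd h (by simp)

/-- a checked level certificate proves the level inequality `Good N` -/
theorem good_of_checkLevel (N : ℕ) (ps : List ℕ) (pcs : List PC)
    (h : checkLevel N ps pcs = true) : Good N := by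
  simp only [checkLevel, Bool.and_eq_true, List.all_eq_true, beq_iff_eq] at h
  obtain ⟨⟨⟨⟨hndB, hallP⟩, hN⟩, hmap⟩, hfin⟩ := h
  have hnd := nodup_of_nodupB ps hndB
  have hps : ∀ p ∈ ps, p.Prime := fun p hp => prime_of_isPrimeB p (hallP p hp)
  split at hfin
  · rename_i s hs
    simp only [Nat.blt_eq] at hfin
    have hmem : ∀ c ∈ pcs, c.p ∈ ps := fun c hc => hmap ▸ List.mem_map.mpr ⟨c, hc, rfl⟩
    have hle := sum_le_of_sumBounds N ps hps hnd hN pcs s hmem hs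
    rw [hmap] at hle
    have hpf : N.primeFactors = ps.toFinset := hN ▸ primeFactors_prod_primes ps hps hnd
    have htot : N.totient = (ps.map (· - 1)).prod := hN ▸ totient_prod_primes ps hps hnd
    have hle' : (ps.map (fun p => tau N p)).sum ≤ s := hle
    unfold Good
    rw [hpf, List.sum_toFinset _ hnd, htot]
    calc 6 * (ps.map (fun p => tau N p)).sum ≤ 6 * s := Nat.mul_le_mul_left 6 hle'
      _ < (ps.map (· - 1)).prod := hfin
  · exact absurd hfin (by simp)

/-! ## 6. The range walk -/

/-- Type-A certificate `⟨p, k, 0, []⟩`: `p ^ k ≡ -1 (mod N/p)`. -/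
def A (p k : ℕ) : PC := ⟨p, k, 0, []⟩

/-- Type-B certificate `⟨p, 0, d, fac⟩`: `d = ord_{N/p}(p)` with the factorisation `fac` of `d`. -/
def B (p d : ℕ) (fac : List (ℕ × ℕ)) : PC := ⟨p, 0, d, fac⟩

/-- Certificate for one `N` prime to `6`: `P` = `N` is prime (the level `[N]` with `τ(N, N) = 0` in `ZMod 1`),
`S q` = `q² ∣ N` (not squarefree), `L ps pcs` = a composite squarefree level. -/
inductive Entry where
  | P : Entry
  | S (q : ℕ) : Entry
  | L (ps : List ℕ) (pcs : List PC) : Entry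

/-- check one entry of the certificate list against the level `N` -/
def entryOK (N : ℕ) : Entry → Bool
  | .P => checkLevel N [N] [A N 1]
  | .S q => Nat.ble 2 q && (N % (q * q) == 0)
  | .L ps pcs => checkLevel N ps pcs

/-- a checked entry proves `Good N` for squarefree `N` -/
theorem entryOK_sound (N : ℕ) (e : Entry) (h : entryOK N e = true) (hsq : Squarefree N) : Good N := by
  cases e with
  | P => exact good_of_checkLevel N [N] [A N 1] h
  | S q =>
      simp only [entryOK, Bool.and_eq_true, Nat.ble_eq, beq_iff_eq] at h
      have hqq : q * q ∣ N := Nat.dvd_of_mod_eq_zero h.2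
      have := Nat.isUnit_iff.mp (hsq q hqq)
      omega
  | L ps pcs => exact good_of_checkLevel N ps pcs h

/-- Walk `N = top - fuel, …, top - 1`; numbers divisible by `2` or `3` are skipped, every other
`N` consumes one entry, which must check. -/
def walk (top : ℕ) : ℕ → List Entry → Bool
  | 0, _ => true
  | fuel + 1, es =>
      if (top - (fuel + 1)) % 2 = 0 ∨ (top - (fuel + 1)) % 3 = 0 then walk top fuel es
      else match es with
        | [] => false
        | e :: es' => entryOK (top - (fuel + 1)) e && walk top fuel es'

/-- soundness of the certificate walk -/
theorem walk_sound (top : ℕ) : ∀ (fuel : ℕ) (es : List Entry), walk top fuel es = true →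
    ∀ n, top - fuel ≤ n → n < top → ¬ 2 ∣ n → ¬ 3 ∣ n → Squarefree n → Good n
  | 0, es, _, n, h1, h2, _, _, _ => by omega
  | fuel + 1, es, h, n, h1, h2, h2n, h3n, hsq => by
      rcases Nat.eq_or_lt_of_le h1 with heq | hlt
      · -- n is the current number
        unfold walk at h
        split_ifs at h with hdiv
        · exfalso
          rw [heq] at hdiv
          rcases hdiv with h0 | h0
          · exact h2n (Nat.dvd_of_mod_eq_zero h0)
          · exact h3n (Nat.dvd_of_mod_eq_zero h0)
        · split at h
          · exact absurd h (by simp)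
          · rename_i e es'
            simp only [Bool.and_eq_true] at h
            rw [heq] at h
            exact entryOK_sound n e h.1 hsq
      · unfold walk at h
        split_ifs at h with hdiv
        · exact walk_sound top fuel es h n (by omega) h2 h2n h3n hsq
        · split at h
          · exact absurd h (by simp)
          · rename_i e es'
            simp only [Bool.and_eq_true] at h
            exact walk_sound top fuel es' h.2 n (by omega) h2 h2n h3n hsq

/-- The range statement `URange a (a + k)` of `HypUDefs.lean` from a checked walk. -/
theorem uRange_of_walk (a k : ℕ) (es : List Entry) (hw : walk (a + k) k es = true) : URange a (a + k) :=
  fun n ha hb _ hsq h2 h3 => walk_sound (a + k) k es hw n (by omega) hb h2 h3 hsq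

/-- The levels `2, 3, 4` are not prime to `6`. -/
theorem uRange_2_5 : URange 2 5 := by
  intro n h2 h5 _ _ h2n h3n
  interval_cases n <;> omega

/-! ## 7. A test walk (`N < 36`) -/

/-- test certificates for the levels `5 ≤ N < 36` prime to `6` -/
def esTest : List Entry :=
  [.P, .P, .P, .P, .P, .P, .P, .S 5, .P, .P, .L [5, 7] [A 5 3, A 7 2]]

/-- the test walk checks (kernel evaluation) -/
theorem walk_test : walk 36 31 esTest = true := by decide +kernel

/-- `URange 2 36` from the test walk -/
theorem uRange_test : URange 2 36 := uRange_append uRange_2_5 (uRange_of_walk 5 31 esTest walk_test)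

end HodgeFermat.KRFree.HypUCert
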